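import Literature.Barriers.CriticalPhenomena.ScaleCovarianceNotMoebius
import Literature.MathematicalPhysics.QuantumFieldTheory.PointwiseOSReconstruction

/-!
# `InversionUpgradeNormalised` (item stmt-CriticalPhenomena-1982): the model-blind no-go witnesses are NOT reflection positive

Negative knowledge about the crux
`Summit.CriticalPhenomena.Ising3DConformalLimit.Theses.HyperoctahedralRP.InversionUpgradeNormalised`
(standing crux disprover; cycle 1 as p68995, bounced on a gate restart, re-proved in cycle 2).
The barrier `Literature.Barriers.CriticalPhenomena.ScaleCovarianceNotMoebiusNarrow` says in prose
(evasions_known (1)) that its witness `ScaleNotMoebius.narrowFamily Δ` is not reflection positive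
as a family because `S₆ ≡ 0 ≢ S₄`. Here this is a theorem in the tree's pointwise OS language
(`Literature.MathematicalPhysics.QuantumFieldTheory.IsReflectionPositiveAlong`): along every
coordinate axis `τ`, the OS Gram matrix of the two point-insertion vectors "three spins at
`e_τ, 2e_τ, 3e_τ`" and "one spin at `4e_τ`" has a vanishing diagonal entry (`S₆ = 0`) and positive
off-diagonal entries (`S₄ > 0` on non-coincident configurations, by the Griffiths-II lower bound
`narrowFamily_griffithsII`), so it is not positive semidefinite (OS Cauchy–Schwarz).

Consequence for provers: the whole model-blind no-go class of the barrier (thirteen surrogates,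
lattice provenance `not_inversionUpgrade_of_latticeLimit_at`, reflection monotonicity) is
DISJOINT from reflection positivity; lines built on OS reconstruction of the full family
(light-cone/modular, `PositivityBegetsConformality`, `ModularBoosts`, nine-mirror RP of
`HyperoctahedralRP`) are not touched by it.
-/

noncomputable section

namespace Summit.CriticalPhenomena.Ising3DConformalLimit.InversionUpgradeNormalisedNegative

open Literature.Probability.LatticeModels Literature.Barriers.CriticalPhenomena
open Literature.MathematicalPhysics.QuantumFieldTheory
open Set Function ScaleNotMoebius

/-- `S₄ > 0` at every non-coincident configuration (`Δ ≥ 0`): Griffiths-II lower bound by a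
Wick term, which is a product of two positive `twoPt`. [folklore] -/
theorem narrowFamily_four_pos {Δ : ℝ} (hΔ : 0 ≤ Δ) {x : Fin 4 → EuclideanSpace ℝ (Fin 3)}
    (hx : Injective x) : 0 < narrowFamily Δ 4 x := by
  have h := (narrowFamily_griffithsII hΔ x hx).1
  have h01 : 0 < narrowFamily Δ 2 ![x 0, x 1] := by
    rw [narrowFamily_two]
    exact twoPt_pos Δ (hx.ne (show (0 : Fin 4) ≠ 1 by decide))
  have h23 : 0 < narrowFamily Δ 2 ![x 2, x 3] := by
    rw [narrowFamily_two]
    exact twoPt_pos Δ (hx.ne (show (2 : Fin 4) ≠ 3 by decide))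
  exact lt_of_lt_of_le (mul_pos h01 h23) h

/-- **`narrowFamily Δ` is NOT reflection positive** along any coordinate axis (`Δ ≥ 0`): in the
OS Gram matrix of the two vectors "three spins at `e_τ,2e_τ,3e_τ`" (configuration `A`) and "one spin
at `4e_τ`" (configuration `B`) the diagonal entry `K(A,A) = S₆ ≡ 0` vanishes while the off-diagonal
entries `K(A,B), K(B,A)` are values of `S₄ > 0` at non-coincident configurations — impossible for a
positive semidefinite matrix: with coefficients `(t, -(s+s')/2)`, `t = K(B,B) > 0`, `s = K(A,B)`,
`s' = K(B,A)`, the OS form equals `-t(s+s')²/4 < 0` (OS Cauchy–Schwarz). [folklore] -/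
theorem narrowFamily_not_reflectionPositive {Δ : ℝ} (hΔ : 0 ≤ Δ) (τ : Fin 3) :
    ¬ IsReflectionPositiveAlong τ (narrowFamily Δ) := by
  intro hRP
  -- the two half-space configurations
  let A : HalfSpaceConfig 3 τ :=
    { n := 3
      pts := fun i => EuclideanSpace.single τ (((i : ℕ) : ℝ) + 1)
      injective := by
        intro i j hij
        have h : ((i : ℕ) : ℝ) + 1 = ((j : ℕ) : ℝ) + 1 := by
          simpa using congrArg (fun z : EuclideanSpace ℝ (Fin 3) => z τ) hij
        exact Fin.ext (Nat.cast_injective (R := ℝ) (by linarith))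
      pos := fun i => by simp; positivity }
  let B : HalfSpaceConfig 3 τ :=
    { n := 1
      pts := fun _ => EuclideanSpace.single τ 4
      injective := Function.injective_of_subsingleton _
      pos := fun i => by simp }
  have hAA : osPointKernel (narrowFamily Δ) A A = 0 := rfl
  have hAB : 0 < osPointKernel (narrowFamily Δ) A B :=
    narrowFamily_four_pos hΔ (osPointKernel_arg_injective A B)
  have hBA : 0 < osPointKernel (narrowFamily Δ) B A :=
    narrowFamily_four_pos hΔ (osPointKernel_arg_injective B A)
  have hBB : 0 < osPointKernel (narrowFamily Δ) B B := by
    have hinj := osPointKernel_arg_injective B B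
    show 0 < narrowFamily Δ 2 _
    rw [narrowFamily_two]
    exact twoPt_pos Δ (hinj.ne (show (0 : Fin 2) ≠ 1 by decide))
  set s := osPointKernel (narrowFamily Δ) A B with hs
  set s' := osPointKernel (narrowFamily Δ) B A with hs'
  set t := osPointKernel (narrowFamily Δ) B B with ht
  have key := hRP 2 ![A, B] ![t, -(s + s') / 2]
  simp only [Fin.sum_univ_two, Matrix.cons_val_zero, Matrix.cons_val_one] at key
  rw [hAA, ← hs, ← hs', ← ht] at key
  nlinarith [mul_pos hBB (mul_pos (add_pos hAB hBA) (add_pos hAB hBA))]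

/-- All three axes at once. [folklore] -/
theorem narrowFamily_not_reflectionPositive_all {Δ : ℝ} (hΔ : 0 ≤ Δ) :
    ∀ τ : Fin 3, ¬ IsReflectionPositiveAlong τ (narrowFamily Δ) :=
  fun τ => narrowFamily_not_reflectionPositive hΔ τ

/-- No witness of the sharpened barrier statement obtained from `narrowFamily` admits the pointwise
OS reconstruction along any axis (its first field is reflection positivity). [folklore] -/
theorem narrowFamily_not_pointwiseOSReconstruction {Δ : ℝ} (hΔ : 0 ≤ Δ) (τ : Fin 3) :
    ¬ PointwiseOSReconstruction τ (narrowFamily Δ) :=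
  fun h => narrowFamily_not_reflectionPositive hΔ τ h.reflectionPositive

end Summit.CriticalPhenomena.Ising3DConformalLimit.InversionUpgradeNormalisedNegative

end
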